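import Summits.AtomisticToContinuum.HydrodynamicLimit.Theorems.RelayRaceLocalityNearConstantShortTimeHLGoodEventPackage
import Summits.AtomisticToContinuum.HydrodynamicLimit.Theorems.RelayRaceLocalityNearConstantShortTimeHLMomentCapDefs
import HarnessLib

/-!
# Crux `NearConstantShortTimeHL` (stmt-AtomisticToContinuum-12502), line `small-tilt-domination`, skeleton v14 (lead c7):
# `good_event_package4` — the good events under the FOURTH-MOMENT CAP

Support file (`--supports stmt-AtomisticToContinuum-12502`). Skeleton v14 re-types the equilibrium closure K-stubs with the fourth-moment
cap `n⁻¹ Σᵢ ‖vᵢ(r)‖⁴ ≤ K` inside the conditioning event (`MomentumClosureTightness4` / `EnergyClosureTightness4`, `…MomentCapDefs`; the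
uniform-rate stubs S2/S3 of v2–v13 are physics-level false as typed: the needle-beam witness of `SUSPECT-FALSE-14424.md` scales with the
window, `Cruxes/NearConstantShortTimeHL/Lines/small-tilt-domination-S2S3-stub-false.md`). This file re-proves level 1a of the Grönwall
assembly in that currency: the landed `good_event_package` (p130016) VERBATIM, with (i) one more conjunct `momentCapOn (Φ N) z window K` in
the four families of closure-defect events, (ii) one more cap failure `{∃ r ∈ [0,t], K < n⁻¹ Σᵢ ‖vᵢ(r)‖⁴}` in the bad event (its
probability `→ 0` along the true law is the new hypothesis, the a-priori input `FourthMomentCapPreShock`), (iii) the fourth-moment cap on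
`[0,t]` read off the good event and fed to the avoided events. Same conclusion as `good_event_package`, so the dynamic theorem
(`…Dynamic4`) is the landed proof of `stub_dynamic` with this package. All the `xx_*` helpers are the landed ones.
References: H.-T. Yau, Lett. Math. Phys. 22 (1991) §2.
-/

noncomputable section

namespace Summit.AtomisticToContinuum.HydrodynamicLimit.Theorems.NearConstantShortTimeHL

open scoped BigOperators ENNReal
open MeasureTheory Set Filter Topology
open Literature.MathematicalPhysics.KineticTheory Literature.Analysis.FluidPDE Literature.Analysis.FunctionSpaces

/-- The fourth-moment cap restricts to sub-windows (registered). [folklore] -/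
theorem momentCapOn_mono : ∀ {ε' : ℝ} {n' : ℕ} {Φ : HardSphereFlow (Torus.geometry (Fin 3)) ε' n'} {z : Config n' (Fin 3) T3} {S S' : Set ℝ} {K : ℝ}, momentCapOn Φ z S K → S' ⊆ S → momentCapOn Φ z S' K :=
  fun h hS r hr => h r (hS hr)

/-- **`good_event_package4` — the good events under the fourth-moment cap (level 1a of the Grönwall assembly of skeleton v14).**
Verbatim `good_event_package` with the fourth-moment cap `momentCapOn … K` added to the conditioning events of the closure bounds
`hKmom` / `hKen` and the cap failure `{∃ r ∈ [0,t], K < n⁻¹ Σᵢ ‖vᵢ(r)‖⁴}` (probability `→ 0` along the true law) added to the bad event;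
same conclusion. The good events of Yau's
method, eventually in `N`: a `C¹` constant `Λ` of the log-profile rows, a diagonal grid index `ι(N) → ∞`,
measurable good events `G' N` with `P N (G' N)ᶜ → 0`, and eventually `0 < ι N`, `0 < ℓ_N < 1/2`, the modulus
`1/(ι N + 1)` of `∂ₜλ⁰, ∂ₜλ, ∂ₜλ⁴, ∇λ⁰` at scale `ℓ_N` on `[0, t]`, and on `G' N` the speed and packing caps on
`[0, t]` together with the closure-defect bounds `2Λ/(ι N + 1)²` for the plain rows on the windows
`[0, (k+1)t/ι]` and the time-weighted rows on the cells `[jt/ι, (j+1)t/ι]` (event import + closure K-stubs +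
cap failures, through `exists_goodEvents_of_import`). [cite: Yau1991, §2] -/
theorem good_event_package4 : ∀ {η₀ : ℝ} {F : ℝ → ℝ}, 0 < η₀ → AnalyticOnNhd ℝ F (Set.Ioo (-η₀) η₀) → Set.EqOn hsExcessFreeEnergy F (Set.Ico 0 η₀) → ∀ {σ T : ℝ}, 0 < σ → ∀ {ρ θ : ℝ → T3 → ℝ} {u : ℝ → T3 → V3}, IsHardSphereEulerSolution σ T ρ u θ → ∀ {t : ℝ}, t ∈ Set.Ico 0 T → 0 < t → t < 1 → (∀ s ∈ Set.Icc 0 t, ∀ x, ρ s x * σ ^ 3 < η₀) → ∀ {ηP : ℝ} {ε : ℕ → ℝ} {n : ℕ → ℕ}, Tendsto n atTop atTop → ∀ (Φ : (N : ℕ) → HardSphereFlow (Torus.geometry (Fin 3)) (ε N) (n N)) (P G : (N : ℕ) → Measure (Config (n N) (Fin 3) T3)) {aI c₀ : ℝ}, aI < c₀ → (∀ N (S : Set (Config (n N) (Fin 3) T3)), P N S ≤ ENNReal.ofReal (Real.exp (aI * n N)) * G N S) → ∀ {η₂ η₃ : ℝ}, ηP ≤ η₂ → ηP ≤ η₃ →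 ∀ {K : ℝ}, (∀ (s τ : ℝ), 0 ≤ s → 0 < τ → s + τ ≤ 1 → ∀ ψ : ℝ → T3 → V3, Torus.IsSmoothSpaceTimeOn (Set.Icc s (s + τ)) ψ → (∀ r ∈ Set.Icc s (s + τ), ∀ x, ‖ψ r x‖ ≤ 1 ∧ ‖Torus.timeDerivWithin (Set.Icc s (s + τ)) ψ r x‖ ≤ 1 ∧ ∀ i, ‖Torus.partialDeriv i (ψ r) x‖ ≤ 1) → ∀ δ : ℝ, 0 < δ → ∀ᶠ N : ℕ in atTop, G N {z | speedCapOn (Φ N) z (Set.Icc s (s + τ)) ((n N : ℝ) ^ (1 / 24 : ℝ)) ∧ packCapOn (Φ N) z (Set.Icc s (s + τ)) (mesoRadius (n N)) σ η₂ ∧ momentCapOn (Φ N) z (Set.Icc s (s + τ)) K ∧ δ < |momDefect σ (Φ N) z (mesoRadius (n N)) s τ ψ|} ≤ ENNReal.ofReal (Real.exp (-(c₀ * n N)))) → (∀ (s τ : ℝ), 0 ≤ s → 0 < τ → s + τ ≤ 1 → ∀ φ : ℝ → T3 → ℝ, Torus.IsSmoothSpaceTimeOn (Set.Icc s (s + τ))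 φ → (∀ r ∈ Set.Icc s (s + τ), ∀ x, |φ r x| ≤ 1 ∧ |Torus.timeDerivWithin (Set.Icc s (s + τ)) φ r x| ≤ 1 ∧ ∀ i, |Torus.partialDeriv i (φ r) x| ≤ 1) → ∀ δ : ℝ, 0 < δ → ∀ᶠ N : ℕ in atTop, G N {z | speedCapOn (Φ N) z (Set.Icc s (s + τ)) ((n N : ℝ) ^ (1 / 24 : ℝ)) ∧ packCapOn (Φ N) z (Set.Icc s (s + τ)) (mesoRadius (n N)) σ η₃ ∧ momentCapOn (Φ N) z (Set.Icc s (s + τ)) K ∧ δ < |enDefect σ (Φ N) z (mesoRadius (n N)) s τ φ|} ≤ ENNReal.ofReal (Real.exp (-(c₀ * n N)))) → Tendsto (fun N => P N {z | ∃ r ∈ Set.Icc 0 t, ∃ i, (n N : ℝ) ^ (1 / 24 : ℝ) < ‖((Φ N).flow r z i).2‖}) atTop (nhds 0) → Tendsto (fun N => P N {z | ∃ r ∈ Set.Icc 0 t, ∃ x : T3, ηP < empiricalDensityField ((Φ N).flow r z) (ballKernel (mesoRadius (n N)) x) * σ ^ 3}) atTop (nhds 0) → Tendsto (fun N => P N {z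 | ∃ r ∈ Set.Icc 0 t, K < (n N : ℝ)⁻¹ * ∑ i : Fin (n N), ‖((Φ N).flow r z i).2‖ ^ 4}) atTop (nhds 0) → ∃ Λ : ℝ, 0 < Λ ∧ ∃ ι : ℕ → ℕ, Tendsto ι atTop atTop ∧ ∃ G' : (N : ℕ) → Set (Config (n N) (Fin 3) T3), (∀ N, MeasurableSet (G' N)) ∧ Tendsto (fun N => P N (G' N)ᶜ) atTop (nhds 0) ∧ ∀ᶠ N in atTop, 0 < ι N ∧ 0 < mesoRadius (n N) ∧ mesoRadius (n N) < 1 / 2 ∧ (∀ r ∈ Set.Icc 0 t, ∀ x y : T3, Torus.euclidDist x y < mesoRadius (n N) → |Torus.timeDerivWithin (Set.Ico 0 T) (lam0Row σ ρ θ u) r x - Torus.timeDerivWithin (Set.Ico 0 T) (lam0Row σ ρ θ u) r y| ≤ ((ι N : ℝ) + 1)⁻¹ ∧ ‖Torus.timeDerivWithin (Set.Ico 0 T) (lamRow θ u) r x - Torus.timeDerivWithin (Set.Ico 0 T) (lamRow θ u) r y‖ ≤ ((ι N : ℝ) + 1)⁻¹ ∧ |Torus.timeDerivWithin (Set.Ico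 0 T) (lam4Row θ) r x - Torus.timeDerivWithin (Set.Ico 0 T) (lam4Row θ) r y| ≤ ((ι N : ℝ) + 1)⁻¹ ∧ ∀ k, |Torus.partialDeriv k (lam0Row σ ρ θ u r) x - Torus.partialDeriv k (lam0Row σ ρ θ u r) y| ≤ ((ι N : ℝ) + 1)⁻¹) ∧ ∀ z ∈ G' N, z ∈ (Φ N).good → speedCapOn (Φ N) z (Set.Icc 0 t) ((n N : ℝ) ^ (1 / 24 : ℝ)) ∧ packCapOn (Φ N) z (Set.Icc 0 t) (mesoRadius (n N)) σ ηP ∧ (∀ k : ℕ, k < ι N → |momDefect σ (Φ N) z (mesoRadius (n N)) 0 ((k + 1) * (t / ι N)) (lamRow θ u)| ≤ 2 * Λ / ((ι N : ℝ) + 1) ^ 2 ∧ |enDefect σ (Φ N) z (mesoRadius (n N)) 0 ((k + 1) * (t / ι N)) (lam4Row θ)| ≤ 2 * Λ / ((ι N : ℝ) + 1) ^ 2) ∧ (∀ j : ℕ, j < ι N → |momDefect σ (Φ N) z (mesoRadius (n N)) (j * (t / ι N)) (t / ι N) (fun r y => (j * (t / ι N) + t / ι N - r) • lamRow θ u r y)|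 ≤ 2 * Λ / ((ι N : ℝ) + 1) ^ 2 ∧ |enDefect σ (Φ N) z (mesoRadius (n N)) (j * (t / ι N)) (t / ι N) (fun r y => (j * (t / ι N) + t / ι N - r) * lam4Row θ r y)| ≤ 2 * Λ / ((ι N : ℝ) + 1) ^ 2) := by
  intro η₀ F hη₀ hFa hEqF σ T hσ ρ θ u hE t ht ht0 ht1 hband ηP ε n hn Φ P G aI c₀ hac hImp η₂ η₃ hη₂ hη₃ K
    hKmom hKen hV hW hM4
  -- (0) horizon `T'`, smooth rows on `[0, T')`, `C¹` bounds `Λ` and moduli radii on `[0, t]`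
  obtain ⟨T', htT', hT'T, hband'⟩ := exists_horizon_of_packing_lt hE hσ ht hband
  obtain ⟨hlam0, hlam, hlam4⟩ : Torus.IsSmoothSpaceTimeOn (Set.Ico 0 T') (lam0Row σ ρ θ u) ∧
      Torus.IsSmoothSpaceTimeOn (Set.Ico 0 T') (lamRow θ u) ∧
      Torus.IsSmoothSpaceTimeOn (Set.Ico 0 T') (lam4Row θ) :=
    isSmoothSpaceTimeOn_logProfileRows hη₀ hFa hEqF hσ hE hT'T hband'
  obtain ⟨-, hm0⟩ := exists_bounds_moduli_of_isSmoothSpaceTimeOn hlam0 ht.1 htT'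
  obtain ⟨⟨Λ₁, hΛ₁, hb1, -⟩, hm1⟩ := exists_bounds_moduli_of_isSmoothSpaceTimeOn hlam ht.1 htT'
  obtain ⟨⟨Λ₄, -, hb4, -⟩, hm4⟩ := exists_bounds_moduli_of_isSmoothSpaceTimeOn hlam4 ht.1 htT'
  obtain ⟨Λ, hΛ1, hΛ4, hΛpos⟩ : ∃ Λ : ℝ, Λ₁ ≤ Λ ∧ Λ₄ ≤ Λ ∧ 0 < Λ :=
    ⟨max Λ₁ Λ₄, le_max_left _ _, le_max_right _ _, lt_max_of_lt_left hΛ₁⟩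
  have h2Λ : 0 < 2 * Λ := by positivity
  have hBΛ1 : ∀ r ∈ Set.Icc 0 t, ∀ x, ‖lamRow θ u r x‖ ≤ Λ ∧
      ‖Torus.timeDerivWithin (Set.Ico 0 T') (lamRow θ u) r x‖ ≤ Λ ∧
      ∀ i, ‖Torus.partialDeriv i (lamRow θ u r) x‖ ≤ Λ := fun r hr x =>
    ⟨(hb1 r hr x).1.trans hΛ1, (hb1 r hr x).2.1.trans hΛ1, fun i => ((hb1 r hr x).2.2 i).trans hΛ1⟩
  have hBΛ4 : ∀ r ∈ Set.Icc 0 t, ∀ x, ‖lam4Row θ r x‖ ≤ Λ ∧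
      ‖Torus.timeDerivWithin (Set.Ico 0 T') (lam4Row θ) r x‖ ≤ Λ ∧
      ∀ i, ‖Torus.partialDeriv i (lam4Row θ r) x‖ ≤ Λ := fun r hr x =>
    ⟨(hb4 r hr x).1.trans hΛ4, (hb4 r hr x).2.1.trans hΛ4, fun i => ((hb4 r hr x).2.2 i).trans hΛ4⟩
  have he : ∀ i : ℕ, (0 : ℝ) < ((i : ℝ) + 1)⁻¹ := fun i => by positivity
  have hδ : ∀ i : ℕ, (0 : ℝ) < ((i : ℝ) + 1)⁻¹ ^ 2 := fun i => by positivity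
  choose d0 hd0 hmod0 using hm0
  choose d1 hd1 hmod1 using hm1
  choose d4 hd4 hmod4 using hm4
  obtain ⟨dd, hdd⟩ : ∃ dd : ℕ → ℝ, ∀ i, dd i = min (d0 _ (he i)) (min (d1 _ (he i)) (d4 _ (he i))) :=
    ⟨_, fun _ => rfl⟩
  have hddpos : ∀ i, 0 < dd i := fun i => by
    rw [hdd]
    exact lt_min (hd0 _ _) (lt_min (hd1 _ _) (hd4 _ _))
  -- the admissible normalised tests on the windows `[0, (j+1)t/i]` and the cells `[jt/i, (j+1)t/i]`, `j < i`
  have hw := fun (i j : ℕ) (hij : j < i) => xx_window ht0 ht1 htT' hij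
  have hcl := fun (i j : ℕ) (hij : j < i) => xx_cell ht0 ht1 htT' hij
  have adm0 := fun (i j : ℕ) (hij : j < i) => xx_rowTest_admissible hlam le_rfl (hw i j hij).2.1
    (hw i j hij).2.2.1 hΛpos fun r hr x => hBΛ1 r ((hw i j hij).2.2.2.2 hr) x
  have adm1 := fun (i j : ℕ) (hij : j < i) => xx_rowTest_admissible hlam4 le_rfl (hw i j hij).2.1
    (hw i j hij).2.2.1 hΛpos fun r hr x => hBΛ4 r ((hw i j hij).2.2.2.2 hr) x
  have adm2 := fun (i j : ℕ) (hij : j < i) => xx_weightedRowTest_admissible hlam (hcl i j hij).1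
    (hcl i j hij).2.2.1 (hcl i j hij).2.2.2.1 (hcl i j hij).2.2.2.2.1 hΛpos
    fun r hr x => hBΛ1 r ((hcl i j hij).2.2.2.2.2.2 hr) x
  have adm3 := fun (i j : ℕ) (hij : j < i) => xx_weightedRowTest_admissible hlam4 (hcl i j hij).1
    (hcl i j hij).2.2.1 (hcl i j hij).2.2.2.1 (hcl i j hij).2.2.2.2.1 hΛpos
    fun r hr x => hBΛ4 r ((hcl i j hij).2.2.2.2.2.2 hr) x
  -- (1) the closure-defect events of grid size `i`: type `q % 4`, window/cell index `q / 4`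
  obtain ⟨E, hE⟩ : ∃ E : ℕ → ℕ → (N : ℕ) → Set (Config (n N) (Fin 3) T3), ∀ i q N, E i q N =
      if q % 4 = 0 then
        {z | speedCapOn (Φ N) z (Set.Icc 0 (0 + (((q / 4 : ℕ) : ℝ) + 1) * (t / i))) ((n N : ℝ) ^ (1 / 24 : ℝ)) ∧
          packCapOn (Φ N) z (Set.Icc 0 (0 + (((q / 4 : ℕ) : ℝ) + 1) * (t / i))) (mesoRadius (n N)) σ η₂ ∧
          momentCapOn (Φ N) z (Set.Icc 0 (0 + (((q / 4 : ℕ) : ℝ) + 1) * (t / i))) K ∧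
          ((i : ℝ) + 1)⁻¹ ^ 2 < |momDefect σ (Φ N) z (mesoRadius (n N)) 0 ((((q / 4 : ℕ) : ℝ) + 1) * (t / i))
            (fun r y => Λ⁻¹ • lamRow θ u r y)|}
      else if q % 4 = 1 then
        {z | speedCapOn (Φ N) z (Set.Icc 0 (0 + (((q / 4 : ℕ) : ℝ) + 1) * (t / i))) ((n N : ℝ) ^ (1 / 24 : ℝ)) ∧
          packCapOn (Φ N) z (Set.Icc 0 (0 + (((q / 4 : ℕ) : ℝ) + 1) * (t / i))) (mesoRadius (n N)) σ η₃ ∧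
          momentCapOn (Φ N) z (Set.Icc 0 (0 + (((q / 4 : ℕ) : ℝ) + 1) * (t / i))) K ∧
          ((i : ℝ) + 1)⁻¹ ^ 2 < |enDefect σ (Φ N) z (mesoRadius (n N)) 0 ((((q / 4 : ℕ) : ℝ) + 1) * (t / i))
            (fun r y => Λ⁻¹ • lam4Row θ r y)|}
      else if q % 4 = 2 then
        {z | speedCapOn (Φ N) z (Set.Icc (((q / 4 : ℕ) : ℝ) * (t / i)) (((q / 4 : ℕ) : ℝ) * (t / i) + t / i))
            ((n N : ℝ) ^ (1 / 24 : ℝ)) ∧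
          packCapOn (Φ N) z (Set.Icc (((q / 4 : ℕ) : ℝ) * (t / i)) (((q / 4 : ℕ) : ℝ) * (t / i) + t / i))
            (mesoRadius (n N)) σ η₂ ∧
          momentCapOn (Φ N) z (Set.Icc (((q / 4 : ℕ) : ℝ) * (t / i)) (((q / 4 : ℕ) : ℝ) * (t / i) + t / i)) K ∧
          ((i : ℝ) + 1)⁻¹ ^ 2 < |momDefect σ (Φ N) z (mesoRadius (n N)) (((q / 4 : ℕ) : ℝ) * (t / i)) (t / i)
            (fun r y => (2 * Λ)⁻¹ • ((((q / 4 : ℕ) : ℝ) * (t / i) + t / i - r) • lamRow θ u r y))|}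
      else
        {z | speedCapOn (Φ N) z (Set.Icc (((q / 4 : ℕ) : ℝ) * (t / i)) (((q / 4 : ℕ) : ℝ) * (t / i) + t / i))
            ((n N : ℝ) ^ (1 / 24 : ℝ)) ∧
          packCapOn (Φ N) z (Set.Icc (((q / 4 : ℕ) : ℝ) * (t / i)) (((q / 4 : ℕ) : ℝ) * (t / i) + t / i))
            (mesoRadius (n N)) σ η₃ ∧
          momentCapOn (Φ N) z (Set.Icc (((q / 4 : ℕ) : ℝ) * (t / i)) (((q / 4 : ℕ) : ℝ) * (t / i) + t / i)) K ∧
          ((i : ℝ) + 1)⁻¹ ^ 2 < |enDefect σ (Φ N) z (mesoRadius (n N)) (((q / 4 : ℕ) : ℝ) * (t / i)) (t / i)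
            (fun r y => (2 * Λ)⁻¹ • ((((q / 4 : ℕ) : ℝ) * (t / i) + t / i - r) • lam4Row θ r y))|} :=
    ⟨_, fun _ _ _ => rfl⟩
  -- `G`-exponential smallness of every event, for each fixed grid size `i` (the closure K-stubs)
  have hEsmall : ∀ i, ∀ q < 4 * i, ∀ᶠ N in atTop,
      G N (E i q N) ≤ ENNReal.ofReal (Real.exp (-(c₀ * n N))) := by
    intro i q hq
    have hj : q / 4 < i := by omega
    obtain h | h | h | h : q % 4 = 0 ∨ q % 4 = 1 ∨ q % 4 = 2 ∨ q % 4 = 3 := by omega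
    · refine (hKmom 0 _ le_rfl (hw i _ hj).1 (hw i _ hj).2.2.2.1 _ (adm0 i _ hj).1 (adm0 i _ hj).2 _
        (hδ i)).mono fun N hN => ?_
      rw [hE, if_pos h]
      exact hN
    · refine (hKen 0 _ le_rfl (hw i _ hj).1 (hw i _ hj).2.2.2.1 _ (adm1 i _ hj).1
        (xx_abs_of_norm (adm1 i _ hj).2) _ (hδ i)).mono fun N hN => ?_
      rw [hE, if_neg (show ¬q % 4 = 0 by omega), if_pos h]
      exact hN
    · refine (hKmom _ _ (hcl i _ hj).1 (hcl i _ hj).2.1 (hcl i _ hj).2.2.2.2.2.1 _ (adm2 i _ hj).1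
        (adm2 i _ hj).2 _ (hδ i)).mono fun N hN => ?_
      rw [hE, if_neg (show ¬q % 4 = 0 by omega), if_neg (show ¬q % 4 = 1 by omega), if_pos h]
      exact hN
    · refine (hKen _ _ (hcl i _ hj).1 (hcl i _ hj).2.1 (hcl i _ hj).2.2.2.2.2.1 _ (adm3 i _ hj).1
        (xx_abs_of_norm (adm3 i _ hj).2) _ (hδ i)).mono fun N hN => ?_
      rw [hE, if_neg (show ¬q % 4 = 0 by omega), if_neg (show ¬q % 4 = 1 by omega),
        if_neg (show ¬q % 4 = 2 by omega)]
      exact hN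
  -- side conditions (`ℓ_N → 0`), cap failures, and (2) the engine: diagonal index and good events
  have hmeso : Tendsto (fun N => mesoRadius (n N)) atTop (nhds 0) :=
    (tendsto_rpow_neg_atTop (by norm_num : (0 : ℝ) < 1 / 4)).comp (tendsto_natCast_atTop_atTop.comp hn)
  have hp : ∀ i, ∀ᶠ N in atTop,
      0 < mesoRadius (n N) ∧ mesoRadius (n N) < 1 / 2 ∧ mesoRadius (n N) < dd i := fun i =>
    ((hn.eventually_ge_atTop 1).mono fun N hN => show 0 < mesoRadius (n N) from
      Real.rpow_pos_of_pos (Nat.cast_pos.2 (Nat.lt_of_lt_of_le Nat.zero_lt_one hN)) _).and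
      ((hmeso.eventually_lt_const (by norm_num)).and (hmeso.eventually_lt_const (hddpos i)))
  have hBlim := hV.add (hW.add hM4)
  simp only [add_zero] at hBlim
  obtain ⟨ι, hι, hιp, G', hG'm, hG'P, hG'av⟩ := exists_goodEvents_of_import P G n hn hac hImp (fun i => 4 * i)
    E hEsmall (fun i N => 0 < mesoRadius (n N) ∧ mesoRadius (n N) < 1 / 2 ∧ mesoRadius (n N) < dd i) hp
    (fun N => {z | ∃ r ∈ Set.Icc 0 t, ∃ i, (n N : ℝ) ^ (1 / 24 : ℝ) < ‖((Φ N).flow r z i).2‖} ∪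
      ({z | ∃ r ∈ Set.Icc 0 t, ∃ x : T3,
        ηP < empiricalDensityField ((Φ N).flow r z) (ballKernel (mesoRadius (n N)) x) * σ ^ 3} ∪
      {z | ∃ r ∈ Set.Icc 0 t, K < (n N : ℝ)⁻¹ * ∑ i : Fin (n N), ‖((Φ N).flow r z i).2‖ ^ 4}))
    (tendsto_of_tendsto_of_tendsto_of_le_of_le tendsto_const_nhds hBlim (fun N => zero_le)
      fun N => (measure_union_le _ _).trans (add_le_add le_rfl (measure_union_le _ _)))
  refine ⟨Λ, hΛpos, ι, hι, G', hG'm, hG'P, ?_⟩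
  -- (3) eventually in `N`: unpack
  filter_upwards [hιp, hG'av, hι.eventually_ge_atTop 1] with N hpN havN hι1
  obtain ⟨hmpos, hmhalf, hmdd⟩ := hpN
  refine ⟨Nat.lt_of_lt_of_le Nat.zero_lt_one hι1, hmpos, hmhalf, fun r hr x y hxy => ?_, fun z hz _ => ?_⟩
  · -- the modulus of the derivative fields at scale `ℓ_N < dd (ι N)`, moved from `[0, T')` to `[0, T)`
    have hrT' : r ∈ Set.Ico 0 T' := ⟨hr.1, hr.2.trans_lt htT'⟩
    rw [hdd] at hmdd
    obtain ⟨-, h0t, h0x⟩ := hmod0 _ (he (ι N)) r hr x y (hxy.trans (hmdd.trans_le (min_le_left _ _)))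
    obtain ⟨-, h1t, -⟩ := hmod1 _ (he (ι N)) r hr x y
      (hxy.trans (hmdd.trans_le ((min_le_right _ _).trans (min_le_left _ _))))
    obtain ⟨-, h4t, -⟩ := hmod4 _ (he (ι N)) r hr x y
      (hxy.trans (hmdd.trans_le ((min_le_right _ _).trans (min_le_right _ _))))
    rw [← timeDerivWithin_Ico_eq_of_le hT'T (lam0Row σ ρ θ u) hrT' x,
      ← timeDerivWithin_Ico_eq_of_le hT'T (lam0Row σ ρ θ u) hrT' y,
      ← timeDerivWithin_Ico_eq_of_le hT'T (lamRow θ u) hrT' x,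
      ← timeDerivWithin_Ico_eq_of_le hT'T (lamRow θ u) hrT' y,
      ← timeDerivWithin_Ico_eq_of_le hT'T (lam4Row θ) hrT' x,
      ← timeDerivWithin_Ico_eq_of_le hT'T (lam4Row θ) hrT' y]
    exact ⟨(Real.norm_eq_abs _).symm.trans_le h0t, h1t, (Real.norm_eq_abs _).symm.trans_le h4t,
      fun k => (Real.norm_eq_abs _).symm.trans_le (h0x k)⟩
  · -- on the good event: caps on `[0, t]` (no cap failure); defect bounds (avoidance + linearity)
    have hzB := havN.1 hz
    simp only [Set.mem_compl_iff, Set.mem_union, Set.mem_setOf_eq, not_or, not_exists, not_and,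
      not_lt] at hzB
    have hspeed : speedCapOn (Φ N) z (Set.Icc 0 t) ((n N : ℝ) ^ (1 / 24 : ℝ)) :=
      fun r hr i => hzB.1 r hr i
    have hpack : packCapOn (Φ N) z (Set.Icc 0 t) (mesoRadius (n N)) σ ηP := fun r hr x => hzB.2.1 r hr x
    have hmom : momentCapOn (Φ N) z (Set.Icc 0 t) K := fun r hr => hzB.2.2 r hr
    have hav : ∀ q : ℕ, q < 4 * ι N → z ∉ E (ι N) q N := fun q hq => havN.2 q hq hz
    refine ⟨hspeed, hpack, fun k hk => ⟨?_, ?_⟩, fun j hj => ⟨?_, ?_⟩⟩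
    · -- plain momentum row on the window `[0, (k+1) t/ι]`
      have h := hav (4 * k) (by omega)
      rw [hE, if_pos (show 4 * k % 4 = 0 by omega), show 4 * k / 4 = k by omega] at h
      simp only [Set.mem_setOf_eq, not_and, not_lt] at h
      exact (xx_mom_of_normalised (Φ N) z _ (hw _ k hk).1 hΛpos (adm0 _ k hk).1
        (h (fun r hr i => hspeed r ((hw _ k hk).2.2.2.2 hr) i)
          (fun r hr x => (hpack r ((hw _ k hk).2.2.2.2 hr) x).trans hη₂)
          (momentCapOn_mono hmom (hw _ k hk).2.2.2.2))).trans (xx_bound hΛpos _).1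
    · -- plain energy row on the window `[0, (k+1) t/ι]`
      have h := hav (4 * k + 1) (by omega)
      rw [hE, if_neg (show ¬(4 * k + 1) % 4 = 0 by omega), if_pos (show (4 * k + 1) % 4 = 1 by omega),
        show (4 * k + 1) / 4 = k by omega] at h
      simp only [Set.mem_setOf_eq, not_and, not_lt] at h
      exact (xx_en_of_normalised (Φ N) z _ (hw _ k hk).1 hΛpos (adm1 _ k hk).1
        (h (fun r hr i => hspeed r ((hw _ k hk).2.2.2.2 hr) i)
          (fun r hr x => (hpack r ((hw _ k hk).2.2.2.2 hr) x).trans hη₃)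
          (momentCapOn_mono hmom (hw _ k hk).2.2.2.2))).trans (xx_bound hΛpos _).1
    · -- time-weighted momentum row on the cell `[j t/ι, (j+1) t/ι]`
      have h := hav (4 * j + 2) (by omega)
      rw [hE, if_neg (show ¬(4 * j + 2) % 4 = 0 by omega), if_neg (show ¬(4 * j + 2) % 4 = 1 by omega),
        if_pos (show (4 * j + 2) % 4 = 2 by omega), show (4 * j + 2) / 4 = j by omega] at h
      simp only [Set.mem_setOf_eq, not_and, not_lt] at h
      exact (xx_mom_of_normalised (Φ N) z _ (hcl _ j hj).2.1 h2Λ (adm2 _ j hj).1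
        (h (fun r hr i => hspeed r ((hcl _ j hj).2.2.2.2.2.2 hr) i)
          (fun r hr x => (hpack r ((hcl _ j hj).2.2.2.2.2.2 hr) x).trans hη₂)
          (momentCapOn_mono hmom (hcl _ j hj).2.2.2.2.2.2))).trans_eq (xx_bound hΛpos _).2
    · -- time-weighted energy row on the cell `[j t/ι, (j+1) t/ι]`
      have h := hav (4 * j + 3) (by omega)
      rw [hE, if_neg (show ¬(4 * j + 3) % 4 = 0 by omega), if_neg (show ¬(4 * j + 3) % 4 = 1 by omega),
        if_neg (show ¬(4 * j + 3) % 4 = 2 by omega), show (4 * j + 3) / 4 = j by omega] at h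
      simp only [Set.mem_setOf_eq, not_and, not_lt] at h
      exact (xx_en_of_normalised (Φ N) z _ (hcl _ j hj).2.1 h2Λ (adm3 _ j hj).1
        (h (fun r hr i => hspeed r ((hcl _ j hj).2.2.2.2.2.2 hr) i)
          (fun r hr x => (hpack r ((hcl _ j hj).2.2.2.2.2.2 hr) x).trans hη₃)
          (momentCapOn_mono hmom (hcl _ j hj).2.2.2.2.2.2))).trans_eq (xx_bound hΛpos _).2


end Summit.AtomisticToContinuum.HydrodynamicLimit.Theorems.NearConstantShortTimeHL

end
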